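import Literature.Geometry.Lorentzian.HypersurfaceDevelopmentGluing
import Literature.Geometry.Lorentzian.HypersurfaceCorrespondingBoundaryShadow
import Literature.Geometry.Lorentzian.CauchyProblemMGHDExistence
import Literature.Geometry.Lorentzian.CauchyDevelopmentCausal
import Literature.Geometry.Lorentzian.TimelikeCurveLiftLocal
import Summits.FinalStateConjecture.FinalStateConjecture.Theorems.PhaseMixingCaptureCaptureSufficesC2StubHypersurfaceMGHDRealisedRealise
import Summits.FinalStateConjecture.FinalStateConjecture.Theorems.PhaseMixingCaptureCaptureSufficesC2StubHypersurfaceMGHDRealised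
import Summits.FinalStateConjecture.FinalStateConjecture.Theorems.PhaseMixingCaptureCaptureSufficesC2StubHypersurfaceMGHDRealisedShadowRegion
import Summits.FinalStateConjecture.FinalStateConjecture.Theorems.SwallowTheDatumSubdataDevelopmentsEmbed
import HarnessLib

/-!
# Crux `CaptureSufficesC2` (stmt-FinalStateConjecture-14986), line `Sketch` — stub
# `stub_hypersurfaceMGHDRealised` (S2), part 4: the stub from the named fact
# `choquetBruhat_geroch_exists_mghd_cauchy` ALONE

**Theorem (`stub_hypersurfaceMGHDRealised_of_choquetBruhatGeroch`).** Under the named fact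
`Literature.Geometry.Lorentzian.choquetBruhat_geroch_exists_mghd_cauchy` (existence of the MGHD
of smooth vacuum data; Choquet-Bruhat–Geroch 1969, Thm. 3), the registered statement of
`stub_hypersurfaceMGHDRealised` holds: for a MAXIMAL vacuum Cauchy development `𝓜` and a smooth
embedding `j : N → 𝓜` with future unit normal inducing the data `D'` on `N`, with `j(N)` ACAUSAL,
`D'` has a maximal vacuum Cauchy development realised inside `𝓜` by a smooth isometric
time-orientation preserving open embedding `χ` with `χ ∘ ι' = j`.

Proof: the shadow domain `W` of `j(N)` (part 3, `…StubHypersurfaceMGHDRealisedShadowRegion.lean`: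
open, connected, `j(N)` Cauchy in `W`, containing the compact-shadow points of `I±(j N)`) is fed to
`realised_of_shadowRegion`, the shadow form of the localisation argument of part 2
(`realised_of_region`): `W` with the structures of `𝓜` is a vacuum Cauchy development `R` of `D'`;
a maximal development `M` of `D'` exists by the named fact; `R` realised in `M` through
`θ : R → M` gives a common sub-development `(U, ψ)` of `M` and `𝓜` over `j` with `ψ(U) = W`; a
cluster value of `ψ` at `∂U` would be a corresponding boundary pair, excluded by
`LorentzianMetric.false_of_corresponding_shadow` (the image point has compact shadow, hence lies
in `W`); so `𝓜 ∪_ψ M` is a vacuum Cauchy development of the datum of `𝓜`, absorbed by the maximal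
`𝓜` through `ζ`, and `χ = ζ ∘ j'` with `ζ ∘ jZ = id` (rigidity). This removes the
domain-of-dependence hypothesis (DoD) of part 2 — whose printed proofs (O'Neill 1983,
Lemma 14.43) use limit curves — in favour of the shadow domain, built without them.

No definitions, no new named facts; the named fact is displayed.
-/

noncomputable section

set_option linter.dupNamespace false

open Function Set Filter Topology TopologicalSpace Bundle
open scoped Manifold ContDiff Topology

namespace Summit.FinalStateConjecture.FinalStateConjecture.Theorems.CaptureSufficesC2.Sketch

open Literature.Geometry.Lorentzian
open Summit.FinalStateConjecture.FinalStateConjecture.Theorems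

namespace HypersurfaceMGHDRealised

/-- **Stub S2 at one hypersurface, from Choquet-Bruhat–Geroch existence and a region `W` with
the SHADOW properties** (the workhorse of the closure below): as `realised_of_region` (part 2),
but with the domain-of-dependence hypotheses (hD±) on `W` replaced by (hDsh±) — `W` contains every
`q ∈ I⁺(j N)` (resp. `I⁻(j N)`) whose shadow `I⁻(q) ∩ j(N)` (resp. `I⁺(q) ∩ j(N)`) lies in a
compact subset of `j(N)` —, the "no corresponding boundary points" step being
`LorentzianMetric.false_of_corresponding_shadow`. Under the named fact
`choquetBruhat_geroch_exists_mghd_cauchy`, `D'` has a maximal vacuum Cauchy development realised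
inside `𝓜` by a smooth isometric time-orientation preserving open embedding `χ` with
`χ ∘ ι' = j`. [cite: HawkingEllis1973CUP, §7.6, pp. 249–251]
[cite: ChoquetBruhatGeroch1969CMP, Thm. 3 and p. 334] -/
theorem realised_of_shadowRegion
    (hcbg : Literature.Geometry.Lorentzian.choquetBruhat_geroch_exists_mghd_cauchy)
    {X : Type} [TopologicalSpace X] [ChartedSpace E3 X] [IsManifold (𝓡 3) ∞ X] [ConnectedSpace X]
    {D : InitialDataSet (𝓡 3) X} (𝓜 : VacuumCauchyDevelopment D) (hmax : 𝓜.IsMaximal)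
    {N : Type} [TopologicalSpace N] [ChartedSpace E3 N] [IsManifold (𝓡 3) ∞ N] [ConnectedSpace N]
    {D' : InitialDataSet (𝓡 3) N} {j : N → 𝓜.carrier} {ν : NormalField (𝓡 4) j}
    (hj : Manifold.IsSmoothEmbedding (𝓡 3) (𝓡 4) ∞ j)
    (hν : 𝓜.metric.IsFutureUnitNormal (𝓡 3) 𝓜.timeOrientation j ν)
    (hh : ∀ y : N, pullbackBilin (I := 𝓡 4) (I' := 𝓡 3) j 𝓜.metric.val y = D'.h.inner y)
    (hk : ∀ [𝓜.metric.toPseudoRiemannianMetric.HasLeviCivita] (y : N),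
      𝓜.metric.toPseudoRiemannianMetric.secondFundamentalForm (𝓡 3) j ν y = D'.kBilin y)
    (hac : ∀ p ∈ Set.range j, ∀ q ∈ Set.range j,
      q ∈ 𝓜.metric.causalFuture 𝓜.timeOrientation {p} → q = p)
    {W : Opens 𝓜.carrier} (hjW : range j ⊆ W) (hWc : IsConnected (W : Set 𝓜.carrier))
    (hWC : (𝓜.metric.restrict PseudoRiemannianMetric.contMDiff_restrict_holds W).IsCauchyHypersurface
      (𝓜.timeOrientation.restrict PseudoRiemannianMetric.contMDiff_restrict_holds
        𝓜.timeOrientation.contMDiff_restrict_holds W) (Subtype.val ⁻¹' range j))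
    (hDp : ∀ q ∈ 𝓜.metric.chronologicalFuture 𝓜.timeOrientation (Set.range j),
      (∃ C : Set 𝓜.carrier, C ⊆ Set.range j ∧ IsCompact C ∧
        𝓜.metric.chronologicalPast 𝓜.timeOrientation {q} ∩ Set.range j ⊆ C) → q ∈ W)
    (hDm : ∀ q ∈ 𝓜.metric.chronologicalPast 𝓜.timeOrientation (Set.range j),
      (∃ C : Set 𝓜.carrier, C ⊆ Set.range j ∧ IsCompact C ∧
        𝓜.metric.chronologicalFuture 𝓜.timeOrientation {q} ∩ Set.range j ⊆ C) → q ∈ W) :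
    ∃ 𝒟' : VacuumCauchyDevelopment D', 𝒟'.IsMaximal ∧
      ∃ χ : 𝒟'.carrier → 𝓜.carrier, ContMDiff (𝓡 4) (𝓡 4) ∞ χ ∧ Topology.IsOpenEmbedding χ ∧
        𝒟'.metric.IsIsometricImmersion 𝓜.metric.toPseudoRiemannianMetric χ ∧
        𝒟'.timeOrientation.PreservesTimeOrientation χ 𝓜.timeOrientation ∧ χ ∘ 𝒟'.embed = j := by
  classical
  have hn2 : (2 : ℕ∞ω) ≤ ∞ := WithTop.coe_le_coe.mpr le_top
  -- `N` is Hausdorff and second countable (embedded in `𝓜`)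
  haveI : T2Space N := hj.isEmbedding.t2Space
  haveI : SecondCountableTopology N := hj.isEmbedding.secondCountableTopology
  -- `j(N)` is achronal
  have hachr : ∀ p ∈ range j, ∀ q ∈ range j,
      q ∉ 𝓜.metric.chronologicalFuture 𝓜.timeOrientation {p} := by
    intro p hp q hq hpq
    have hqp : q = p :=
      hac p hp q hq (LorentzianMetric.chronologicalFuture_subset_causalFuture _ _ _ hpq)
    subst hqp
    obtain ⟨z, hz, γ, a, b, hab, hγ, hγa, hγb⟩ := hpq
    rw [mem_singleton_iff] at hz
    exact 𝓜.toCauchyDevelopment.isChronological γ a b hab hγ (by rw [hγa, hγb, hz])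
  -- `W` as a vacuum Cauchy development `R` of `D'`, with its inclusion `k`
  obtain ⟨R, k, hks, hki, hkt, hkinj, hkc, hkW⟩ :=
    exists_restricted_development 𝓜 hj hν hh hk hjW hWc hWC
  haveI : Nonempty R.carrier := inferInstance
  have hkd : MDifferentiable (𝓡 4) (𝓡 4) k := hks.mdifferentiable (by simp)
  have hkloc : IsLocalDiffeomorph (𝓡 4) (𝓡 4) ∞ k :=
    LorentzianMetric.isLocalDiffeomorph_of_isIsometricImmersion hki
  -- a maximal development `M` of `D'` (the named fact) and `θ : R → M`
  obtain ⟨M, hM⟩ := exists_isMaximal_of_nonempty_of_choquetBruhatGeroch hcbg N D' ⟨R⟩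
  obtain ⟨θ, hθs, hθo, hθi, hθt, hθc⟩ := hM R
  have hθloc : IsLocalDiffeomorph (𝓡 4) (𝓡 4) ∞ θ :=
    LorentzianMetric.isLocalDiffeomorph_of_isIsometricImmersion hθi
  -- realise `R` inside `M` through `θ`: `(U, ψ) = (θ(R), k ∘ θ⁻¹)`
  obtain ⟨U, ψ, hP, hUeq, hinj, hψθ⟩ := exists_realised_into R.toCauchyDevelopment
    M.toCauchyDevelopment 𝓜.toSpacetime j hθs hθo hθi hθt hθc hks hki hkt hkc hkinj
  have hι : ∀ u, M.embed u ∈ U := hP.1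
  have hUC := hP.2.2.1
  have hψs : ContMDiffOn (𝓡 4) (𝓡 4) ∞ ψ U := hP.2.2.2.1
  have hψc : ψ ∘ M.embed = j := hP.2.2.2.2.2.2
  -- `ψ(U) = W`
  have himage : ψ '' (U : Set M.carrier) = (W : Set 𝓜.carrier) := by
    rw [hUeq, ← hkW]
    ext z
    constructor
    · rintro ⟨_, ⟨r, rfl⟩, rfl⟩
      exact ⟨r, (hψθ r).symm⟩
    · rintro ⟨r, rfl⟩
      exact ⟨θ r, ⟨r, rfl⟩, hψθ r⟩
  have hψW : MapsTo ψ (U : Set M.carrier) (W : Set 𝓜.carrier) := fun x hx ↦ by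
    have h : ψ x ∈ ψ '' (U : Set M.carrier) := mem_image_of_mem ψ hx
    rwa [himage] at h
  have hWψ : (W : Set 𝓜.carrier) ⊆ ψ '' (U : Set M.carrier) := by rw [himage]
  have hS₁U : range M.embed ⊆ (U : Set M.carrier) := by
    rintro _ ⟨u, rfl⟩
    exact hι u
  have hψS : ψ '' range M.embed = range j := by rw [← range_comp, hψc]
  -- `ψ` maps open subsets of `U` to open sets
  have hopen : ∀ B : Set M.carrier, IsOpen B → IsOpen (ψ '' (B ∩ (U : Set M.carrier))) := by
    intro B hB
    have heq : ψ '' (B ∩ (U : Set M.carrier)) = k '' (θ ⁻¹' B) := by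
      rw [hUeq]
      ext z
      constructor
      · rintro ⟨_, ⟨hb, r, rfl⟩, rfl⟩
        exact ⟨r, hb, (hψθ r).symm⟩
      · rintro ⟨r, hr, rfl⟩
        exact ⟨θ r, ⟨hr, r, rfl⟩, hψθ r⟩
    rw [heq]
    exact hkloc.isLocalHomeomorph.isOpenMap _ (hB.preimage hθs.continuous)
  -- `ψ` pushes timelike segments of `M` inside `U` forward
  have hpush : ∀ ⦃γ : ℝ → M.carrier⦄ ⦃a b : ℝ⦄, a < b →
      M.metric.IsFutureTimelikeCurveOn M.timeOrientation γ (Icc a b) →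
      (∀ t ∈ Icc a b, γ t ∈ U) →
      ψ (γ b) ∈ 𝓜.metric.chronologicalFuture 𝓜.timeOrientation {ψ (γ a)} := by
    intro γ a b hab hγ hγU
    have hγU' : ∀ t ∈ Icc a b, γ t ∈ range θ := fun t ht ↦ by
      rw [← hUeq]; exact hγU t ht
    have hδ := hγ.invFun_comp hθi hθt hθo.injective hθloc hγU'
    have hkδ : 𝓜.metric.IsFutureTimelikeCurveOn 𝓜.timeOrientation (k ∘ (invFun θ ∘ γ))
        (Icc a b) := hδ.comp_isIsometricImmersion hkd hkt hki.2
    have hend : ∀ t ∈ Icc a b, ψ (γ t) = (k ∘ (invFun θ ∘ γ)) t := fun t ht ↦ by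
      have h := hψθ ((invFun θ ∘ γ) t)
      rwa [show θ ((invFun θ ∘ γ) t) = γ t from invFun_eq (hγU' t ht)] at h
    rw [hend a (left_mem_Icc.2 hab.le), hend b (right_mem_Icc.2 hab.le)]
    exact ⟨_, rfl, k ∘ (invFun θ ∘ γ), a, b, hab, hkδ, rfl, rfl⟩
  -- `ψ⁻¹` pulls timelike segments of `𝓜` inside `W` back
  have hpull : ∀ ⦃γ : ℝ → 𝓜.carrier⦄ ⦃a b : ℝ⦄, a < b →
      𝓜.metric.IsFutureTimelikeCurveOn 𝓜.timeOrientation γ (Icc a b) →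
      (∀ t ∈ Icc a b, γ t ∈ W) → ∀ ⦃x y : M.carrier⦄, x ∈ U → y ∈ U → γ a = ψ x → γ b = ψ y →
      y ∈ M.metric.chronologicalFuture M.timeOrientation {x} := by
    intro γ a b hab hγ hγW x y hx hy hγa hγb
    have hγW' : ∀ t ∈ Icc a b, γ t ∈ range k := fun t ht ↦ by rw [hkW]; exact hγW t ht
    have hδ := hγ.invFun_comp hki hkt hkinj hkloc hγW'
    have hθδ : M.metric.IsFutureTimelikeCurveOn M.timeOrientation (θ ∘ (invFun k ∘ γ))
        (Icc a b) := hδ.comp_isIsometricImmersion (hθs.mdifferentiable (by simp)) hθt hθi.2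
    have hxU : x ∈ range θ := by rw [← hUeq]; exact hx
    have hyU : y ∈ range θ := by rw [← hUeq]; exact hy
    obtain ⟨rx, rfl⟩ := hxU
    obtain ⟨ry, rfl⟩ := hyU
    have hxa : (invFun k ∘ γ) a = rx := by
      show invFun k (γ a) = rx
      rw [hγa, hψθ]
      exact leftInverse_invFun hkinj rx
    have hyb : (invFun k ∘ γ) b = ry := by
      show invFun k (γ b) = ry
      rw [hγb, hψθ]
      exact leftInverse_invFun hkinj ry
    refine ⟨θ rx, rfl, θ ∘ (invFun k ∘ γ), a, b, hab, hθδ, ?_, ?_⟩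
    · show θ ((invFun k ∘ γ) a) = θ rx
      rw [hxa]
    · show θ ((invFun k ∘ γ) b) = θ ry
      rw [hyb]
  -- `W ⊆ D̃(j N)`: every endless timelike curve of `𝓜` through a point of `ψ(U)` meets `j(N)`
  have hDt : ∀ x ∈ U, ∀ (γ : ℝ → 𝓜.carrier) (s : Set ℝ),
      𝓜.metric.IsEndlessTimelikeCurve 𝓜.timeOrientation γ s → (∃ t ∈ s, γ t = ψ x) →
      ∃ t ∈ s, γ t ∈ range j := by
    rintro x hx γ s hγ ⟨t₀, ht₀, hγt₀⟩
    have hW₀ : γ t₀ ∈ range k := by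
      rw [hkW, hγt₀]
      exact hψW hx
    obtain ⟨δ, hδγ, hδ⟩ := LorentzianMetric.exists_lift_isEndlessTimelikeCurve R.timeOrientation
      𝓜.timeOrientation hki hkt hkinj hkloc hγ ht₀ hW₀
    obtain ⟨t, ⟨htJ, u, hu⟩, -⟩ := R.isCauchyHypersurface δ _ hδ
    refine ⟨t, (connectedComponentIn_subset _ _ htJ).1, u, ?_⟩
    rw [← hδγ t htJ, ← hu]
    exact (congrFun hkc u).symm
  -- no cluster point of `ψ` along `U` at `∂U` (no corresponding boundary points)
  have hncb : ∀ p ∈ frontier (U : Set M.carrier), ∀ q : 𝓜.carrier,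
      ¬ ClusterPt q (map ψ (𝓝[(U : Set M.carrier)] p)) := by
    intro p hp q hq
    have hcorr : ∀ V ∈ 𝓝 p, ∀ V' ∈ 𝓝 q, ∃ y ∈ (U : Set M.carrier), y ∈ V ∧ ψ y ∈ V' := by
      intro V hV V' hV'
      have hmem : ψ '' (V ∩ (U : Set M.carrier)) ∈ map ψ (𝓝[(U : Set M.carrier)] p) :=
        image_mem_map (Filter.inter_mem (mem_nhdsWithin_of_mem_nhds hV) self_mem_nhdsWithin)
      obtain ⟨z, hzV', y, ⟨hyV, hyU⟩, rfl⟩ := (clusterPt_iff_nonempty.1 hq) hV' hmem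
      exact ⟨y, hyU, hyV, hzV'⟩
    exact LorentzianMetric.false_of_corresponding_shadow hn2 hn2
      PseudoRiemannianMetric.contMDiff_restrict_holds M.timeOrientation.contMDiff_restrict_holds
      PseudoRiemannianMetric.contMDiff_restrict_holds 𝓜.timeOrientation.contMDiff_restrict_holds
      M.isCauchyHypersurface hS₁U hUC hachr hWC hψW hWψ hψs.continuousOn hinj hopen hψS
      hpush hpull
      M.isCompact_causalPast_inter_causalFuture_range
      M.isCompact_causalFuture_inter_causalPast_range
      (fun hx hy hxy ↦ 𝓜.toCauchyDevelopment.mem_causalFuture_of_tendsto hx hy hxy)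
      hDp hDm hp hcorr
  -- the gluing `Z = 𝓜 ∪_ψ M`, receiving `M` by `j'`
  obtain ⟨Z, jZ, j', ⟨hjZs, -, hjZi, hjZt, hjZc⟩, ⟨hj's, hj'o, hj'i, hj't⟩, hcompat⟩ :=
    VacuumCauchyDevelopment.exists_hypersurface_extension_of_not_clusterPt M 𝓜 j hachr U ψ hP
      hinj hDt hncb
  -- maximality of `𝓜` absorbs `Z`; rigidity makes `ζ ∘ jZ` the identity
  obtain ⟨ζ, hζs, hζo, hζi, hζt, hζc⟩ := hmax Z
  have hζd : MDifferentiable (𝓡 4) (𝓡 4) ζ := hζs.mdifferentiable (by simp)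
  have hid : ζ ∘ jZ = id :=
    𝓜.toDataEmbedding.eq_id_of_comp_embed_eq' (hζi.comp hjZi)
      (hζt.comp hjZt hζi.2 hζd (hjZs.mdifferentiable (by simp)))
      (by rw [comp_assoc, hjZc]; exact hζc)
  refine ⟨M, hM, ζ ∘ j', hζs.comp hj's, hζo.comp hj'o, hζi.comp hj'i,
    hζt.comp hj't hζi.2 hζd (hj's.mdifferentiable (by simp)), ?_⟩
  funext u
  show ζ (j' (M.embed u)) = j u
  rw [hcompat _ (hι u), show ψ (M.embed u) = j u from congrFun hψc u]
  exact congrFun hid (j u)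


end HypersurfaceMGHDRealised

open HypersurfaceMGHDRealised

/-! ### The stub from the named fact alone -/

/-- **Registered sub-goal `stub_hypersurfaceMGHDRealised_of_choquetBruhatGeroch`: Stub S2 from
the named fact `choquetBruhat_geroch_exists_mghd_cauchy`** (Choquet-Bruhat–Geroch 1969, Thm. 3;
Hawking–Ellis 1973, §7.6, relative to a hypersurface): the shadow domain of `j(N)`
(`exists_shadowRegion`, part 3) fed to `realised_of_shadowRegion`.
[cite: ChoquetBruhatGeroch1969CMP, Thm. 3 and p. 334] [cite: HawkingEllis1973CUP, §7.6, pp. 249–251] -/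
theorem stub_hypersurfaceMGHDRealised_of_choquetBruhatGeroch : (choquetBruhat_geroch_exists_mghd_cauchy) → ∀ (X : Type) [TopologicalSpace X] [ChartedSpace E3 X] [IsManifold (𝓡 3) ∞ X] [T2Space X] [SecondCountableTopology X] [ConnectedSpace X] (D : InitialDataSet (𝓡 3) X) (𝓜 : VacuumCauchyDevelopment D), 𝓜.IsMaximal → ∀ (N : Type) [TopologicalSpace N] [ChartedSpace E3 N] [IsManifold (𝓡 3) ∞ N] [ConnectedSpace N] (D' : InitialDataSet (𝓡 3) N) (j : N → 𝓜.carrier) (ν : NormalField (𝓡 4) j), Manifold.IsSmoothEmbedding (𝓡 3) (𝓡 4) ∞ j → 𝓜.metric.IsFutureUnitNormal (𝓡 3) 𝓜.timeOrientation j ν → (∀ y : N, pullbackBilin (I := 𝓡 4) (I' := 𝓡 3) j 𝓜.metric.val y = D'.h.inner y) → (∀ [𝓜.metric.toPseudoRiemannianMetric.HasLeviCivita] (y : N), 𝓜.metric.toPseudoRiemannianMetric.secondFundamentalForm (𝓡 3) j ν y = D'.kBilin y) → (∀ p ∈ Set.range j, ∀ q ∈ Set.range j, q ∈ 𝓜.metric.causalFuture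 𝓜.timeOrientation {p} → q = p) → ∃ 𝒟' : VacuumCauchyDevelopment D', 𝒟'.IsMaximal ∧ ∃ χ : 𝒟'.carrier → 𝓜.carrier, ContMDiff (𝓡 4) (𝓡 4) ∞ χ ∧ Topology.IsOpenEmbedding χ ∧ 𝒟'.metric.IsIsometricImmersion 𝓜.metric.toPseudoRiemannianMetric χ ∧ 𝒟'.timeOrientation.PreservesTimeOrientation χ 𝓜.timeOrientation ∧ χ ∘ 𝒟'.embed = j :=
  fun hcbg _ _ _ _ _ _ _ _ 𝓜 hmax _ _ _ _ _ _ _ _ hj hν hh hk hac ↦ by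
    obtain ⟨W, hjW, hWc, hWC, hDp, hDm⟩ := exists_shadowRegion 𝓜 hj hν hh hk hac
    exact realised_of_shadowRegion hcbg 𝓜 hmax hj hν hh hk hac hjW hWc hWC hDp hDm

end Summit.FinalStateConjecture.FinalStateConjecture.Theorems.CaptureSufficesC2.Sketch

end
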